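/-
Copyright (c) 2026 the pub-hodgecm-mathlib formalisation cell (harness21).  Prover seat hodgecm-mathlib-R90-C131-p05 (g3) on the S4 valve (dealer K2E2-plan (g8), S4-R61 ∕
S4-R69 (M-3b); design authority K2E4-p11 (g10)), road (J̃♭) MODEL, file (M-3b): THE LOCAL ε-TWISTED TUBE-JACOBIAN SOCKET («W-LOC», the `hloc` row of ★ (TJ5-abs))
AT EVERY BASE POINT OF A CENTRALISER TORUS IN THE ONE-PLACE MODEL `G ≃ GL_m(K)` — ★ (M-3a)'s chart data + ★ DATUM + ★ `exists_depth` + ★ WL2′, assembled.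
Crux H413 `stmt-HodgeConjecture-24833`, lane `--supports … --as helper` (count-neutral).  THEOREMS ONLY (no `def`, no `instance`, no notation, no named-fact hypothesis, no `sorry`).
-/
import Summits.HodgeConjecture.HodgeConjecture.Theorems.R90S4TwistedTubeModelData       -- ★ p865006 (M-3a, K2E4-p11): `exists_twistedTubeChartData` (brings ★ (M-1) `exists_twistedLinearEquiv`, ★ (M-2) `exists_glChart` ∕ `chart_link_gl` ∕ twist letters)
import Summits.HodgeConjecture.HodgeConjecture.Theorems.R90S4TwistedTubeSocketLoss      -- ★ WL2′ (R90-C131-p04): `twistedTubeJacobianLocal_of_chartData_loss` (brings ★ WL1 `levelShift_mono`, ★ C8b-window∕tube∕socket-core)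
import Summits.HodgeConjecture.HodgeConjecture.Theorems.R90S4TwistedTubeDatum           -- ★ DATUM p864838 (K2E4-p11): `exists_lossData` (the letters `(γ, γ′, a)` of a non-integral base point)
import Summits.HodgeConjecture.HodgeConjecture.Theorems.F0P3cStCharTSJacCartanElliptic   -- ★ C8b-model (LH5-p02): `exists_depth` (uniform level shifts + the local-constancy window of the weight)
import HarnessLib

/-!
# R90-TF · S4 (Ch. 13.1–2) · road (J̃♭) MODEL, FILE (M-3b): THE LOCAL ε-TWISTED TUBE-JACOBIAN SOCKET AT EVERY BASE POINT OF A CENTRALISER TORUS, ONE-PLACE MODEL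

Cell `hodgecm-mathlib`, crux H413 (`stmt-HodgeConjecture-24833`, lane `--supports … --as helper`), route of record `HCCMUnconditional` (no route verbs; count-neutral).
Programme R90-TF, section S4 = [Rogawski1990] Ch. 13.1–13.2 (twisted Weyl integration formula, §12.5 p. 186: the factor `D_G(N δ)`); seat R90-C131-p05 (g3);
ORDER = S4 dealer K2E2-plan (g8) S4-R61 ∕ S4-R69: (M-3b) of the MODEL cut (K2E4-p11 (g10) (M-1) ★ p864950 `R90S4TwistedLinearEquiv` + (M-3a) ★ `R90S4TwistedTubeModelData`,
R90-C131-p04 (g3) (M-2) ★ p864971 `R90S4TwistedTubeModelChart`, this file).  THEOREMS ONLY — ★ (M-3a) + ★ WL2′ + ★ DATUM + ★ `exists_depth` + ★ `exists_subBox`; ★-only imports.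

THE POINT.  ★ WL2′ `R90S4TwistedTubeSocketLoss.twistedTubeJacobianLocal_of_chartData_loss` (R90-C131-p04) proves the local ε-twisted tube-Jacobian identity «W-LOC» from
47 chart-frame letters at a base point `t₀` that need NOT be integral (loss datum `(γ, γ′, a)`, start depth `k ≥ k₀ + 2a`).  This file DISCHARGES all of them in the
one-place model `G ≃ GL_m(K)` (`ρ : G →* GL_m(K)` inducing, injective, surjective; at the datum `G = G̃_v`, `K = L_w`, `m = 3`, `ρ = localGLPiEvalEquiv`, S4-R61 (κ)):
`V := M_m(K)`, `ι := id`; `σ` a continuous involution of the local field `K` not increasing valuations, `J` hermitian invertible with `J`, `J⁻¹` integral; `ε : G → G`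
the twist read by `ρ(ε g) = J⁻¹ ((ρ g)⁻¹.map σ)ᵀ J`, continuous; `T = ρ⁻¹ Cent(γ)` (`γ` regular) closed; `b₀ ∈ T` ANY base point with `ε b₀ ∈ T`, `b₀ ε(b₀) = ε(b₀) b₀` and
`N b₀ := ρ(b₀ ε b₀)` regular — NO integrality, NO compactness, NO member type; a weight `D : ↥T → ℝ≥0` locally constant at `b₀` whose value at `b₀` is the modulus
`addEquivAddHaarChar L` of EVERY linear part `L` obeying ★ (TJ3)'s two laws at `N b₀` (at the datum `D = cartanWeight ∘ N`, ★ (TJ3) p864488).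
ROAD = ★ `F0P3cStCharTSJacCartanIntegralPoint` steps (0)–(10) with (2) := ★ DATUM `exists_lossData hα1 (ρ b₀)`, (3)–(6)+(8) := ★ (M-3a) `exists_twistedTubeChartData`
(ONE `obtain`), (7) := ★ `exists_depth` (scaling `s = q•` by the residue characteristic `q ∈ ℕ ⊆ K^σ`, ★ `exists_natCast_valuation_lt_one`; `hpMs hpTs hLss` = (M-3a)'s
third block at `σ q = q`) and `k := k₀ + 2a`, ★ `exists_subBox`, (9) := the head's `hDval` fed (M-3a)'s second block, (10) := ★ WL2′.
THE HEAD **`twistedTubeJacobianLocal_model`** returns, ∃-packaged with the chart objects that ★ (TJ5-win) p864964 `R90S4TwistedTubeQuotientWindows` must SHARE with it (the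
(J̃♭-Σ) assembler K2E3-p31 (g3) feeds both to ★ (TJ5-abs) p864907 `twistedTubeJacobian_of_local`): the ratio `α`, levels `Λ`, chart `c`, chart product `σV`, projections
`pM pT`, sub-box `Λ′`, product map `Ξ`, depth `k`, with the (TJ5-win) letters `hΛ hc hcc hK0 hσ hσc hΛ′ hsum hidem hpMc hpTc hshift hΞ hcT hTc`, the twist-window letter
`ε(c X) ∈ c(Λ_j)` (the `hWε` of (TJ5-abs)), and then «W-LOC»: an open `U ∋ b₀` in `T` with `M₀ := c '' (pM '' Λ′ k)` Borel, `m₀ := quotientMeasure T tm _ ν (π(c(Λ′ k)))`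
positive finite, `Ψ` injective on `M₀ × U`, and **`ν (Ψ '' (M₀ ×ˢ V′)) = m₀ * ∫⁻ b in V′, D b ∂tm` for every Borel `V′ ⊆ U`** — the `hloc` binder of ★ (TJ5-abs) VERBATIM
(`K2/K2E3-p03/g10/TJ5-BINDERS.md`, S4-R63), for ANY left-invariant inversion-invariant s-finite `tm` on `↥T` finite on compacts and positive on opens (★ WL2′'s five).

HONEST LABEL: HC_CM is proved only modulo the 7 printed citations (2 remaining named inputs: hLiu418 = `stmt-HodgeConjecture-24832`, h413 = `stmt-HodgeConjecture-24833`)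
until rung 0 closes; this file is the [H-loc] MODEL row of the (J̃♭) letter behind the OPEN (W-NP) socket and closes nothing by itself (REL ≠ ★ ≠ BUILT; count-neutral).

## References
* [Rogawski1990] J. D. Rogawski, *Automorphic Representations of Unitary Groups in Three Variables*, Ann. of Math. Stud. 123 (1990), §12.5 pp. 182, 186 (twisted Weyl
  integration formula; the Jacobian at `δ` depends on `N δ`). Context locator.
* [HarishChandra1970] Harish-Chandra (notes by G. van Dijk), *Harmonic Analysis on Reductive p-adic Groups*, LNM 162 (1970), Part V §4 Lemma 22. Context locator.
* [Labesse1999] J.-P. Labesse, *Cohomologie, stabilisation et changement de base*, Astérisque 257 (1999), §III.1 (twisted orbital integrals, the norm). Context locator.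
* [PlatonovRapinchuk1994] V. Platonov, A. Rapinchuk, *Algebraic Groups and Number Theory* (1994), §3.3 (Cayley chart, congruence filtrations). Context locator.
-/

set_option autoImplicit false
-- the mandated namespace repeats the single-problem summit's segment (`HodgeConjecture.HodgeConjecture`)
set_option linter.dupNamespace false

open Set Filter MeasureTheory MeasureTheory.Measure TopologicalSpace Topology Matrix ValuativeRel
open Literature.NumberTheory.Automorphic Literature.NumberTheory.Weil1982.UnitaryFinTopForm Literature.MeasureTheory.Group Literature.MeasureTheory.Measure
open Summit.HodgeConjecture.HodgeConjecture.Cruxes.H413.F0P3cStCharTSCayleyChartHaar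
open Summit.HodgeConjecture.HodgeConjecture.Cruxes.H413.F0P3cStCharTSTwistedTubeCore (exists_subBox)
open Summit.HodgeConjecture.HodgeConjecture.Cruxes.H413.F0P3cStCharTSJacCartanModelFrame (exists_natCast_valuation_lt_one)
open Summit.HodgeConjecture.HodgeConjecture.Cruxes.H413.F0P3cStCharTSJacCartanElliptic (exists_depth)
open scoped Pointwise Topology ENNReal NNReal MatrixGroups

namespace Summit.HodgeConjecture.HodgeConjecture.R90.S4

variable {K : Type*} [Field K] [ValuativeRel K] [TopologicalSpace K] [IsNonarchimedeanLocalField K] [CharZero K] [SecondCountableTopology K] [T2Space K]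
  {m : ℕ}
  {G : Type*} [Group G] [TopologicalSpace G] [IsTopologicalGroup G] [LocallyCompactSpace G] [SecondCountableTopology G] [T2Space G]
  [MeasurableSpace G] [BorelSpace G]
  [MeasurableSpace (Matrix (Fin m) (Fin m) K)] [BorelSpace (Matrix (Fin m) (Fin m) K)] [LocallyCompactSpace (Matrix (Fin m) (Fin m) K)]

/-- **THE LOCAL ε-TWISTED TUBE-JACOBIAN SOCKET («W-LOC») AT EVERY BASE POINT OF A CENTRALISER TORUS, ONE-PLACE MODEL** — the [H-loc] row of ★ (TJ5-abs)
`twistedTubeJacobian_of_local`.  Frame: `G ≃ GL_m(K)` by `ρ`; `σ`, `J`, `ε`, `T = ρ⁻¹ Cent(γ)` (`γ` regular) closed as in ★ (M-3a); Haar `ν` on `G` (right invariant); ANY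
left-invariant inversion-invariant s-finite measure `tm` on `↥T`, finite on compacts, positive on opens; the family `Ψ (x, b) = x b ε(x)⁻¹`; a base point `b₀ ∈ T` with
`ε b₀ ∈ T`, `b₀ ε(b₀) = ε(b₀) b₀`, `ρ(b₀ ε b₀)` regular (NO integrality); a weight `D : ↥T → ℝ≥0` locally constant at `b₀` with `D b₀ = addEquivAddHaarChar L` for every
`L : M_m(K) ≃ₜ+ M_m(K)` obeying ★ (TJ3)'s two laws at `N := ρ(b₀ ε b₀)`.  Conclusion: chart objects `α Λ c σV pM pT Λ′ Ξ k` with the letters ★ (TJ5-win) shares, the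
twist-window letter `ε(c X) ∈ c(Λ_j)`, and an open `U ∋ b₀` with `M₀ = c '' (pM '' Λ′ k)` Borel, `m₀ = quotientMeasure T tm _ ν (π c(Λ′ k))` positive finite, `Ψ` injective on
`M₀ × U`, and `ν (Ψ '' (M₀ ×ˢ V′)) = m₀ * ∫⁻ b in V′, D b ∂tm` for every Borel `V′ ⊆ U` — ★ WL2′ at ★ (M-3a)'s data, ★ DATUM's loss letters of `ρ b₀`, ★ `exists_depth`'s depth
`k₀` (scaling by the residue characteristic `q ∈ K^σ`) and `k = k₀ + 2a`. [cite: Rogawski1990, §12.5 p. 186] [cite: HarishChandra1970, Lemma 22] [cite: Labesse1999, §III.1]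
[cite: PlatonovRapinchuk1994, §3.3] -/
theorem twistedTubeJacobianLocal_model
    (ρ : G →* GL (Fin m) K) (hρ : IsInducing ρ) (hρinj : Function.Injective ρ) (hρsurj : Function.Surjective ρ)
    (σ : K →+* K) (hσc : Continuous σ) (hσ2 : ∀ a, σ (σ a) = a) (hσv : ∀ x, valuation K (σ x) ≤ valuation K x)
    (J : Matrix (Fin m) (Fin m) K) (hJ : IsUnit J.det) (hJh : (J.map σ)ᵀ = J) (hJ1 : ValBound 1 J) (hJi1 : ValBound 1 J⁻¹)
    (ε : G → G) (hερ : ∀ g : G, ((ρ (ε g) : GL (Fin m) K) : Matrix (Fin m) (Fin m) K) = J⁻¹ * ((((ρ g)⁻¹ : GL (Fin m) K) : Matrix (Fin m) (Fin m) K).map σ)ᵀ * J)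
    (hεc : Continuous ε)
    {γ : GL (Fin m) K} (hγsep : (γ : Matrix (Fin m) (Fin m) K).charpoly.Separable)
    {T : Subgroup G} (hT : ∀ g, g ∈ T ↔ ρ g * γ = γ * ρ g) (hTcl : IsClosed (T : Set G))
    [MeasurableSpace (G ⧸ T)] [BorelSpace (G ⧸ T)]
    (ν : Measure G) [ν.IsHaarMeasure] [ν.IsMulRightInvariant]
    (tm : Measure ↥T) [tm.IsMulLeftInvariant] [IsFiniteMeasureOnCompacts tm] [tm.IsOpenPosMeasure] [tm.IsInvInvariant] [SFinite tm]
    (Ψ : G × ↥T → G) (hΨ : ∀ (x : G) (b : ↥T), Ψ (x, b) = x * b * (ε x)⁻¹)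
    (b₀ : G) (hb₀ : b₀ ∈ T) (hεb₀ : ε b₀ ∈ T) (hcomm : b₀ * ε b₀ = ε b₀ * b₀)
    (hsep : ((ρ (b₀ * ε b₀) : GL (Fin m) K) : Matrix (Fin m) (Fin m) K).charpoly.Separable)
    (D : ↥T → ℝ≥0) (hDlc : ∀ᶠ b in 𝓝 (⟨b₀, hb₀⟩ : ↥T), D b = D ⟨b₀, hb₀⟩)
    (hDval : ∀ L : Matrix (Fin m) (Fin m) K ≃ₜ+ Matrix (Fin m) (Fin m) K,
      (∀ X, X * ((ρ (b₀ * ε b₀) : GL (Fin m) K) : Matrix (Fin m) (Fin m) K) = ((ρ (b₀ * ε b₀) : GL (Fin m) K) : Matrix (Fin m) (Fin m) K) * X → L X = X) →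
      (∀ X Y : Matrix (Fin m) (Fin m) K, X = ((ρ (b₀ * ε b₀) : GL (Fin m) K) : Matrix (Fin m) (Fin m) K) * Y * (((ρ (b₀ * ε b₀))⁻¹ : GL (Fin m) K) : Matrix (Fin m) (Fin m) K) - Y →
        L X = (((ρ b₀)⁻¹ : GL (Fin m) K) : Matrix (Fin m) (Fin m) K) * X * ((ρ b₀ : GL (Fin m) K) : Matrix (Fin m) (Fin m) K) + J⁻¹ * (X.map σ)ᵀ * J) →
      ((D ⟨b₀, hb₀⟩ : ℝ≥0) : ℝ≥0∞) = addEquivAddHaarChar L) :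
    ∃ (α : ValueGroupWithZero K) (Λ : ℕ → AddSubgroup (Matrix (Fin m) (Fin m) K)) (c : Matrix (Fin m) (Fin m) K → G)
      (σV : Matrix (Fin m) (Fin m) K → Matrix (Fin m) (Fin m) K → Matrix (Fin m) (Fin m) K)
      (pM pT : Matrix (Fin m) (Fin m) K →+ Matrix (Fin m) (Fin m) K) (Λ' : ℕ → AddSubgroup (Matrix (Fin m) (Fin m) K))
      (Ξ : Matrix (Fin m) (Fin m) K → Matrix (Fin m) (Fin m) K) (k : ℕ),
      -- ── the chart letters ★ (TJ5-win) consumes (`ι := AddMonoidHom.id`), and the twist-window letter of ★ (TJ5-abs)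
      α ≠ 0 ∧ α < 1 ∧
      (∀ j X, X ∈ Λ j ↔ ValBound (α ^ (j + 1)) X) ∧
      (∀ X ∈ Λ 0, ((ρ (c X) : GL (Fin m) K) : Matrix (Fin m) (Fin m) K) = cayley X) ∧
      ContinuousOn c (Λ 0 : Set (Matrix (Fin m) (Fin m) K)) ∧ IsOpen (c '' (Λ 0 : Set (Matrix (Fin m) (Fin m) K))) ∧
      (∀ W ∈ Λ 0, ∀ X ∈ Λ 0, σV W X = (1 - W)⁻¹ * (W + X) * (1 + W * X)⁻¹ * (1 - W)) ∧
      (∀ W ∈ Λ 0, ContinuousOn (σV W) (Λ 0 : Set (Matrix (Fin m) (Fin m) K))) ∧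
      (∀ j Z, Z ∈ Λ' j ↔ (pM Z ∈ Λ j ∧ pT Z ∈ Λ j)) ∧ (∀ Z, pM Z + pT Z = Z) ∧ (∀ Z, pM (pM Z) = pM Z) ∧ Continuous pM ∧ Continuous pT ∧
      (∀ j, ∀ Z ∈ Λ (j + k), pM Z ∈ Λ j ∧ pT Z ∈ Λ j) ∧
      (∀ Z, Ξ Z = (1 - pM Z)⁻¹ * (pM Z + pT Z) * (1 + pM Z * pT Z)⁻¹ * (1 - pM Z)) ∧
      (∀ Y ∈ Λ 0, pM Y = 0 → c Y ∈ T) ∧ (∀ W ∈ Λ 0, c W ∈ T → pM W = 0) ∧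
      (∀ j, ∀ X ∈ Λ j, ε (c X) ∈ c '' (Λ j : Set (Matrix (Fin m) (Fin m) K))) ∧
      -- ── «W-LOC» at `b₀`: the `hloc` row of ★ (TJ5-abs), with `M₀ = c '' (pM '' Λ′ k)` and `m₀ = quotientMeasure T tm _ ν (π c(Λ′ k))`
      ∃ U : Set ↥T, IsOpen U ∧ (⟨b₀, hb₀⟩ : ↥T) ∈ U ∧
        MeasurableSet (c '' (pM '' (Λ' k : Set (Matrix (Fin m) (Fin m) K)))) ∧
        quotientMeasure T tm hTcl ν ((QuotientGroup.mk : G → G ⧸ T) '' (c '' (Λ' k : Set (Matrix (Fin m) (Fin m) K)))) ≠ 0 ∧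
        quotientMeasure T tm hTcl ν ((QuotientGroup.mk : G → G ⧸ T) '' (c '' (Λ' k : Set (Matrix (Fin m) (Fin m) K)))) ≠ ∞ ∧
        InjOn Ψ ((c '' (pM '' (Λ' k : Set (Matrix (Fin m) (Fin m) K)))) ×ˢ U) ∧
        ∀ V' : Set ↥T, MeasurableSet V' → V' ⊆ U →
          ν (Ψ '' ((c '' (pM '' (Λ' k : Set (Matrix (Fin m) (Fin m) K)))) ×ˢ V')) =
            quotientMeasure T tm hTcl ν ((QuotientGroup.mk : G → G ⧸ T) '' (c '' (Λ' k : Set (Matrix (Fin m) (Fin m) K)))) * ∫⁻ b in V', (D b : ℝ≥0∞) ∂tm := by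
  classical
  -- ### (0) instances on `M_m(K)` from `K`; the additive Haar measure `μ` (it cancels: the conclusion is `κ`-free)
  haveI : SecondCountableTopology (Matrix (Fin m) (Fin m) K) := inferInstanceAs (SecondCountableTopology (Fin m → Fin m → K))
  haveI : T2Space (Matrix (Fin m) (Fin m) K) := inferInstanceAs (T2Space (Fin m → Fin m → K))
  set μ : Measure (Matrix (Fin m) (Fin m) K) := Measure.addHaar with hμdef
  -- ### (1) scalars: the residue characteristic `q`, `α = |q| < 1`, `2 ≠ 0`
  obtain ⟨q, hq0, hq1⟩ := exists_natCast_valuation_lt_one K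
  set α : ValueGroupWithZero K := valuation K (q : K) with hαdef
  have hα : α ≠ 0 := by rw [hαdef, Ne, map_eq_zero]; exact hq0
  have hα1 : α < 1 := hq1
  have h2 : (2 : K) ≠ 0 := two_ne_zero
  -- ### (3)–(6), (8) the chart data at `b₀` (★ (M-3a), one `obtain`)
  obtain ⟨Λ, c, σV, κ, pM, pT, L, E, Ξ, Θ, hΛ, hc, hcc, hK0, hσ, hσc, hsum, hidem, hpMc, hpTc, hΞ, hcT, hTc, hE, hEc, hL, hε, hΘ, hκ0, hκt, hchart,
    -, hLz, hLm, -, -, hpMs, hpTs, -, hLss, h0c, hopenΛ, -⟩ :=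
    exists_twistedTubeChartData ρ hρ hρinj hρsurj σ hσc hσ2 hσv J hJ hJh hJ1 hJi1 ε hερ hγsep hT b₀ hb₀ hεb₀ hcomm hsep hα hα1 h2 μ ν
  have hι : IsClosedEmbedding ⇑(AddMonoidHom.id (Matrix (Fin m) (Fin m) K)) := IsClosedEmbedding.id
  have hΛι : ∀ j X, X ∈ Λ j ↔ ValBound (α ^ (j + 1)) ((AddMonoidHom.id (Matrix (Fin m) (Fin m) K)) X) := hΛ
  have hcι : ∀ X ∈ Λ 0, ((ρ (c X) : GL (Fin m) K) : Matrix (Fin m) (Fin m) K) = cayley ((AddMonoidHom.id (Matrix (Fin m) (Fin m) K)) X) := hc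
  have hanti := level_antitone (AddMonoidHom.id (Matrix (Fin m) (Fin m) K)) Λ hΛι hα1.le
  -- ### (2′) NO integrality: the loss datum `(γ₁, γ₁′, a)` of `ρ b₀` (★ DATUM)
  obtain ⟨γ₁, γ₁', a, hTb, hTinv, hloss⟩ := exists_lossData hα1 (ρ b₀)
  -- ### (7) uniform level shifts at depth `k₀` (scaling by `q ∈ K^σ`, ★ `exists_depth`), the start depth `k := k₀ + 2a`, the sub-box
  have hqσ : σ (q : K) = q := map_natCast σ q
  let s : Matrix (Fin m) (Fin m) K ≃+ Matrix (Fin m) (Fin m) K := (LinearEquiv.smulOfUnit (Units.mk0 (q : K) hq0)).toAddEquiv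
  have hsapp : ∀ Z : Matrix (Fin m) (Fin m) K, s Z = (q : K) • Z := fun Z => by
    show (Units.mk0 (q : K) hq0 : Kˣ) • Z = (q : K) • Z
    rw [Units.smul_mk0]
  have hsι : ∀ Z, (AddMonoidHom.id (Matrix (Fin m) (Fin m) K)) (s Z) = (q : K) • (AddMonoidHom.id (Matrix (Fin m) (Fin m) K)) Z := hsapp
  obtain ⟨k₀, hshift, hshiftL, hDk₀⟩ := exists_depth (AddMonoidHom.id (Matrix (Fin m) (Fin m) K)) Λ hι hΛι hα hα1 s hsι hαdef.symm pM pT L hpMc hpTc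
    (fun Z => by rw [hsapp, hsapp, hpMs]) (fun Z => by rw [hsapp, hsapp, hpTs]) (fun Z => by rw [hsapp, hsapp, hLss _ hqσ]) c hcc h0c hopenΛ
    (⟨b₀, hb₀⟩ : ↥T) D hDlc
  obtain ⟨Λ', hΛ'⟩ := exists_subBox Λ pM pT
  have hk : k₀ + 2 * a ≤ k₀ + 2 * a := le_rfl
  have hshiftk : ∀ j, ∀ Z ∈ Λ (j + (k₀ + 2 * a)), pM Z ∈ Λ j ∧ pT Z ∈ Λ j := levelShift_mono Λ hanti (by omega) hshift
  have hD : ∀ b : ↥T, (b : G) ∈ b₀ • c '' (Λ (k₀ + 2 * a) : Set (Matrix (Fin m) (Fin m) K)) → D b = D ⟨b₀, hb₀⟩ := fun b hb =>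
    hDk₀ b (Set.smul_set_mono (Set.image_mono (hanti (by omega : k₀ ≤ k₀ + 2 * a))) hb)
  -- ### (9) the value of the weight at `b₀`: ★ (TJ3)'s two laws hold for (M-3a)'s `L`
  have hDχ : ((D ⟨b₀, hb₀⟩ : ℝ≥0) : ℝ≥0∞) = addEquivAddHaarChar L := hDval L hLz hLm
  -- ### the twist-window letter `ε (c X) ∈ c(Λ_j)`: `ρ(ε(c X)) = (cayley (E X))⁻¹ = cayley (−E X)`, `−E X ∈ Λ_j`
  have hεwin : ∀ j, ∀ X ∈ Λ j, ε (c X) ∈ c '' (Λ j : Set (Matrix (Fin m) (Fin m) K)) := by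
    intro j X hX
    have hX0 : X ∈ Λ 0 := hanti (Nat.zero_le j) hX
    have hEXj : -(E X) ∈ Λ j := neg_mem ((hΛ j _).2 (hE _ _ ((hΛ j X).1 hX)))
    have hEX0 : -(E X) ∈ Λ 0 := hanti (Nat.zero_le j) hEXj
    have hEXb : ValBound α (E X) := by
      have h := (hΛ 0 _).1 (hanti (Nat.zero_le j) ((hΛ j _).2 (hE _ _ ((hΛ j X).1 hX))))
      rwa [zero_add, pow_one] at h
    refine ⟨-(E X), hEXj, hρinj (Units.ext ?_)⟩
    -- both `ρ(ε(c X))` and `cayley (−E X)` are left inverses of the invertible `cayley (E X)`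
    have hneg : cayley (-(E X)) * cayley (E X) = 1 := cayley_neg_mul_cayley (isUnit_det_one_sub_of_valBound hEXb hα1).1 (isUnit_det_one_add_of_valBound hEXb hα1).1
    have hinv : ((ρ (ε (c X)) : GL (Fin m) K) : Matrix (Fin m) (Fin m) K) * cayley (E X) = 1 := by
      rw [← hε X hX0, ← Units.val_mul, mul_inv_cancel, Units.val_one]
    calc ((ρ (c (-(E X))) : GL (Fin m) K) : Matrix (Fin m) (Fin m) K) = cayley (-(E X)) := hc _ hEX0
      _ = (cayley (E X))⁻¹ := (Matrix.inv_eq_left_inv hneg).symm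
      _ = ((ρ (ε (c X)) : GL (Fin m) K) : Matrix (Fin m) (Fin m) K) := Matrix.inv_eq_left_inv hinv
  -- ### (10) ★ WL2′ at the assembled letters
  have hΞ' : ∀ Z ∈ Λ' (k₀ + 2 * a), (AddMonoidHom.id (Matrix (Fin m) (Fin m) K)) (Ξ Z) =
      (1 - (AddMonoidHom.id (Matrix (Fin m) (Fin m) K)) (pM Z))⁻¹ * ((AddMonoidHom.id (Matrix (Fin m) (Fin m) K)) (pM Z) + (AddMonoidHom.id (Matrix (Fin m) (Fin m) K)) (pT Z)) *
        (1 + (AddMonoidHom.id (Matrix (Fin m) (Fin m) K)) (pM Z) * (AddMonoidHom.id (Matrix (Fin m) (Fin m) K)) (pT Z))⁻¹ *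
          (1 - (AddMonoidHom.id (Matrix (Fin m) (Fin m) K)) (pM Z)) := fun Z _ => hΞ Z
  have hΘ' : ∀ Z ∈ Λ' (k₀ + 2 * a), (AddMonoidHom.id (Matrix (Fin m) (Fin m) K)) (Θ Z) =
      (fun W X : Matrix (Fin m) (Fin m) K => (1 - W)⁻¹ * (W + X) * (1 + W * X)⁻¹ * (1 - W))
        ((((ρ b₀)⁻¹ : GL (Fin m) K) : Matrix (Fin m) (Fin m) K) * (AddMonoidHom.id (Matrix (Fin m) (Fin m) K)) (pM Z) * ((ρ b₀ : GL (Fin m) K) : Matrix (Fin m) (Fin m) K))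
        ((fun W X : Matrix (Fin m) (Fin m) K => (1 - W)⁻¹ * (W + X) * (1 + W * X)⁻¹ * (1 - W)) ((AddMonoidHom.id (Matrix (Fin m) (Fin m) K)) (pT Z))
          (E ((AddMonoidHom.id (Matrix (Fin m) (Fin m) K)) (pM Z)))) := fun Z _ => hΘ Z
  have hL' : ∀ Z, (AddMonoidHom.id (Matrix (Fin m) (Fin m) K)) (L Z) =
      (((ρ b₀)⁻¹ : GL (Fin m) K) : Matrix (Fin m) (Fin m) K) * (AddMonoidHom.id (Matrix (Fin m) (Fin m) K)) (pM Z) * ((ρ b₀ : GL (Fin m) K) : Matrix (Fin m) (Fin m) K) +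
        E ((AddMonoidHom.id (Matrix (Fin m) (Fin m) K)) (pM Z)) + (AddMonoidHom.id (Matrix (Fin m) (Fin m) K)) (pT Z) := hL
  have hσ' : ∀ W ∈ Λ 0, ∀ X ∈ Λ 0, (AddMonoidHom.id (Matrix (Fin m) (Fin m) K)) (σV W X) =
      (1 - (AddMonoidHom.id (Matrix (Fin m) (Fin m) K)) W)⁻¹ * ((AddMonoidHom.id (Matrix (Fin m) (Fin m) K)) W + (AddMonoidHom.id (Matrix (Fin m) (Fin m) K)) X) *
        (1 + (AddMonoidHom.id (Matrix (Fin m) (Fin m) K)) W * (AddMonoidHom.id (Matrix (Fin m) (Fin m) K)) X)⁻¹ * (1 - (AddMonoidHom.id (Matrix (Fin m) (Fin m) K)) W) := hσ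
  have hε' : ∀ X ∈ Λ 0, (((ρ (ε (c X)))⁻¹ : GL (Fin m) K) : Matrix (Fin m) (Fin m) K) = cayley (E ((AddMonoidHom.id (Matrix (Fin m) (Fin m) K)) X)) := hε
  obtain ⟨U, hUo, hb₀U, hM₀m, hne0, hnet, hinj, hid⟩ := twistedTubeJacobianLocal_of_chartData_loss (AddMonoidHom.id (Matrix (Fin m) (Fin m) K)) Λ ρ c σV pM pT L Θ Ξ E ε T
    μ ν tm hTcl hι hΛι hα hα1 h2 hρinj hcι hcc hK0 hσ' hσc hΛ' hsum hidem hpMc hpTc hshift hΞ' hcT hTc hb₀ hTb hTinv hloss hk hE hEc hL' hε' hεc hΘ' hshiftL hκ0 hκt hchart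
    Ψ hΨ D hD hDχ
  exact ⟨α, Λ, c, σV, pM, pT, Λ', Ξ, k₀ + 2 * a, hα, hα1, hΛ, hc, hcc, hK0, hσ, hσc, hΛ', hsum, hidem, hpMc, hpTc, hshiftk, hΞ, hcT, hTc, hεwin,
    U, hUo, hb₀U, hM₀m, hne0, hnet, hinj, hid⟩

end Summit.HodgeConjecture.HodgeConjecture.R90.S4
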